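import Summits.Ventures.LatticeQCDFlow.Scoring.FreeBoundaryIndependence2DRows
import Summits.Ventures.LatticeQCDFlow.Scoring.TorusLocalLimit2D
import Literature.MathematicalPhysics.QuantumFieldTheory.LatticeGaugeProofs
import HarnessLib

/-!
# The exact non-abelian area law in two dimensions, VIII-rb: the covariance of two ROW-separated local observables — zero with free boundary, exponentially small in the volume on the torus

HONEST FRAMING: exact (Metropolis-corrected) sampling algorithms for lattice gauge theory;
figures of merit are autocorrelation/cost numbers at stated couplings and volumes; no
continuum-physics claim.

Venture `LatticeQCDFlow` (cell pub-lqcd), sub-topic `Scoring`; FANOUT row 5 (`s0-sun-a`), GEN-22.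
NEW WORK of the cell (placement rule).  Row twin of part VIII-b (`TorusCovariance2D`), on part VIII-r
(`FreeBoundaryIndependence2DRows`): `Φ₁` sees only the links of the plaquettes of `Q₁ = R₀ × c₁` (corner
`(i, j)`), `Φ₂` only those of `Q₂ = R₀ × T₂` (corner `(i, j + c₁ + k)`), inside `Reg = R₀ × (c₁ + k + T₂)`, `0 < k`;
every compact `G`, continuous weight.

* §1 **`integral_mul_mul_prod_mul_integral_prod_eq_rows`** (complex and real forms) —
  `(∫ Φ₁Φ₂ ∏_{Reg} w)(∫ ∏_{Reg} w) = (∫ Φ₁ ∏_{Reg} w)(∫ Φ₂ ∏_{Reg} w)`: the free-boundary covariance of two local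
  observables a row apart is exactly zero;
* §2 **`abs_wilsonExpectation_mul_sub_mul_le_of_row_gap`** — on the torus `(ℤ/L)²`, theory-2's Wilson state,
  continuous `ρ` with `|Re tr ρ| ≤ B`, EVERY real `β`, `|Φ₁| ≤ A₁`, `|Φ₂| ≤ A₂`:
  `|⟨Φ₁Φ₂⟩_L − ⟨Φ₁⟩_L ⟨Φ₂⟩_L| ≤ 6 A₁ A₂ e^{2|β|(N+B)} (1 − e^{−|β|(N+B)}/m)^{L² − R₀(c₁+k+T₂) − 1}`.

Sequel `TorusClustering2D`.  No `def`, nothing cited as a fact, 0 sorry.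
-/

noncomputable section

open MeasureTheory Function Finset
open Literature.MathematicalPhysics.QuantumFieldTheory
open Literature.MathematicalPhysics.QuantumLattice
open Summit.Ventures.LatticeQCDFlow.Theory2.Lattice
open Summit.Ventures.LatticeQCDFlow.Theory2.Lattice.TwoDim

namespace Summit.Ventures.LatticeQCDFlow.Scoring

variable {L : ℕ} [NeZero L] {G : Type*} [Group G] [TopologicalSpace G] [IsTopologicalGroup G]
  [CompactSpace G] [SecondCountableTopology G] [MeasurableSpace G] [BorelSpace G]

/-! ## §1. The free-boundary covariance of separated observables vanishes -/

section Free

/-- **`(∫ Φ₁Φ₂ ∏_{Reg} w)(∫ ∏_{Reg} w) = (∫ Φ₁ ∏_{Reg} w)(∫ Φ₂ ∏_{Reg} w)`** (complex form, row gap) for `Φ₁`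
seeing only the links of the plaquettes of `Q₁ = R₀ × c₁` at `(i, j)`, `Φ₂` only those of `Q₂ = R₀ × T₂` at
`(i, j + c₁ + k)`, `Reg = R₀ × (c₁ + k + T₂)` at `(i, j)`, `0 < k`, `c₁ + k + T₂ + 1 ≤ L`, `R₀ + 1 ≤ L`. -/
theorem integral_mul_mul_prod_mul_integral_prod_eq_rows {w : G → ℝ} (hw : Continuous w) (i j : ZMod L)
    {c₁ k T₂ R₀ : ℕ} (hk : 0 < k) (hfit : c₁ + k + T₂ + 1 ≤ L) (hR : R₀ + 1 ≤ L)
    {Φ₁ Φ₂ : GaugeConfig 2 L G → ℂ} (hΦ₁ : Continuous Φ₁) (hΦ₂ : Continuous Φ₂)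
    (hΦ₁e : ∀ (e : Edge 2 L) (U : GaugeConfig 2 L G) (g : G),
      (∀ p ∈ (range R₀ ×ˢ range c₁).image (fun q : ℕ × ℕ => (![i + q.1, j + q.2] : Site 2 L)),
        ((p, 0) : Edge 2 L) ≠ e ∧ ((Site.shift p 0, 1) : Edge 2 L) ≠ e ∧
          ((Site.shift p 1, 0) : Edge 2 L) ≠ e ∧ ((p, 1) : Edge 2 L) ≠ e) → Φ₁ (update U e g) = Φ₁ U)
    (hΦ₂e : ∀ (e : Edge 2 L) (U : GaugeConfig 2 L G) (g : G),
      (∀ p ∈ (range R₀ ×ˢ range T₂).image (fun q : ℕ × ℕ => (![i + q.1, j + c₁ + k + q.2] : Site 2 L)),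
        ((p, 0) : Edge 2 L) ≠ e ∧ ((Site.shift p 0, 1) : Edge 2 L) ≠ e ∧
          ((Site.shift p 1, 0) : Edge 2 L) ≠ e ∧ ((p, 1) : Edge 2 L) ≠ e) → Φ₂ (update U e g) = Φ₂ U) :
    (∫ U, Φ₁ U * Φ₂ U *
        ∏ p ∈ (range R₀ ×ˢ range (c₁ + k + T₂)).image (fun q : ℕ × ℕ => (![i + q.1, j + q.2] : Site 2 L)),
          (w (plaquetteHolonomy U p 0 1) : ℂ) ∂(Measure.pi fun _ : Edge 2 L => haarProbability G)) *
      ∫ U, ∏ p ∈ (range R₀ ×ˢ range (c₁ + k + T₂)).image (fun q : ℕ × ℕ => (![i + q.1, j + q.2] : Site 2 L)),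
          (w (plaquetteHolonomy U p 0 1) : ℂ) ∂(Measure.pi fun _ : Edge 2 L => haarProbability G) =
    (∫ U, Φ₁ U *
        ∏ p ∈ (range R₀ ×ˢ range (c₁ + k + T₂)).image (fun q : ℕ × ℕ => (![i + q.1, j + q.2] : Site 2 L)),
          (w (plaquetteHolonomy U p 0 1) : ℂ) ∂(Measure.pi fun _ : Edge 2 L => haarProbability G)) *
      ∫ U, Φ₂ U *
        ∏ p ∈ (range R₀ ×ˢ range (c₁ + k + T₂)).image (fun q : ℕ × ℕ => (![i + q.1, j + q.2] : Site 2 L)),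
          (w (plaquetteHolonomy U p 0 1) : ℂ) ∂(Measure.pi fun _ : Edge 2 L => haarProbability G) := by
  have h1e : ∀ (e : Edge 2 L) (U : GaugeConfig 2 L G) (g : G),
      (∀ p ∈ (range R₀ ×ˢ range c₁).image (fun q : ℕ × ℕ => (![i + q.1, j + q.2] : Site 2 L)),
        ((p, 0) : Edge 2 L) ≠ e ∧ ((Site.shift p 0, 1) : Edge 2 L) ≠ e ∧
          ((Site.shift p 1, 0) : Edge 2 L) ≠ e ∧ ((p, 1) : Edge 2 L) ≠ e) →
        (fun _ : GaugeConfig 2 L G => (1 : ℂ)) (update U e g) = (fun _ => (1 : ℂ)) U := fun _ _ _ _ => rfl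
  have h2e : ∀ (e : Edge 2 L) (U : GaugeConfig 2 L G) (g : G),
      (∀ p ∈ (range R₀ ×ˢ range T₂).image (fun q : ℕ × ℕ => (![i + q.1, j + c₁ + k + q.2] : Site 2 L)),
        ((p, 0) : Edge 2 L) ≠ e ∧ ((Site.shift p 0, 1) : Edge 2 L) ≠ e ∧
          ((Site.shift p 1, 0) : Edge 2 L) ≠ e ∧ ((p, 1) : Edge 2 L) ≠ e) →
        (fun _ : GaugeConfig 2 L G => (1 : ℂ)) (update U e g) = (fun _ => (1 : ℂ)) U := fun _ _ _ _ => rfl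
  have h12 := integral_mul_mul_prod_weight_eq_of_row_gap hw i j hk hfit hR hΦ₁ hΦ₂ hΦ₁e hΦ₂e
  have h10 := integral_mul_mul_prod_weight_eq_of_row_gap hw i j hk hfit hR hΦ₁ continuous_const hΦ₁e h2e
  have h02 := integral_mul_mul_prod_weight_eq_of_row_gap hw i j hk hfit hR continuous_const hΦ₂ h1e hΦ₂e
  have h00 := integral_mul_mul_prod_weight_eq_of_row_gap hw i j hk hfit hR continuous_const continuous_const
    h1e h2e
  simp only [mul_one, one_mul] at h10 h02 h00
  rw [h12, h10, h02, h00]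
  ring

/-- **THE FREE-BOUNDARY COVARIANCE OF ROW-SEPARATED OBSERVABLES VANISHES** (real form): for real continuous
`Φ₁`, `Φ₂` as above and a real continuous weight `w`,
`(∫ Φ₁Φ₂ ∏_{Reg} w)(∫ ∏_{Reg} w) = (∫ Φ₁ ∏_{Reg} w)(∫ Φ₂ ∏_{Reg} w)`. -/
theorem integral_mul_mul_prod_mul_integral_prod_eq_rows_real {w : G → ℝ} (hw : Continuous w) (i j : ZMod L)
    {c₁ k T₂ R₀ : ℕ} (hk : 0 < k) (hfit : c₁ + k + T₂ + 1 ≤ L) (hR : R₀ + 1 ≤ L)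
    {Φ₁ Φ₂ : GaugeConfig 2 L G → ℝ} (hΦ₁ : Continuous Φ₁) (hΦ₂ : Continuous Φ₂)
    (hΦ₁e : ∀ (e : Edge 2 L) (U : GaugeConfig 2 L G) (g : G),
      (∀ p ∈ (range R₀ ×ˢ range c₁).image (fun q : ℕ × ℕ => (![i + q.1, j + q.2] : Site 2 L)),
        ((p, 0) : Edge 2 L) ≠ e ∧ ((Site.shift p 0, 1) : Edge 2 L) ≠ e ∧
          ((Site.shift p 1, 0) : Edge 2 L) ≠ e ∧ ((p, 1) : Edge 2 L) ≠ e) → Φ₁ (update U e g) = Φ₁ U)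
    (hΦ₂e : ∀ (e : Edge 2 L) (U : GaugeConfig 2 L G) (g : G),
      (∀ p ∈ (range R₀ ×ˢ range T₂).image (fun q : ℕ × ℕ => (![i + q.1, j + c₁ + k + q.2] : Site 2 L)),
        ((p, 0) : Edge 2 L) ≠ e ∧ ((Site.shift p 0, 1) : Edge 2 L) ≠ e ∧
          ((Site.shift p 1, 0) : Edge 2 L) ≠ e ∧ ((p, 1) : Edge 2 L) ≠ e) → Φ₂ (update U e g) = Φ₂ U) :
    (∫ U, Φ₁ U * Φ₂ U *
        ∏ p ∈ (range R₀ ×ˢ range (c₁ + k + T₂)).image (fun q : ℕ × ℕ => (![i + q.1, j + q.2] : Site 2 L)),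
          w (plaquetteHolonomy U p 0 1) ∂(Measure.pi fun _ : Edge 2 L => haarProbability G)) *
      ∫ U, ∏ p ∈ (range R₀ ×ˢ range (c₁ + k + T₂)).image (fun q : ℕ × ℕ => (![i + q.1, j + q.2] : Site 2 L)),
          w (plaquetteHolonomy U p 0 1) ∂(Measure.pi fun _ : Edge 2 L => haarProbability G) =
    (∫ U, Φ₁ U *
        ∏ p ∈ (range R₀ ×ˢ range (c₁ + k + T₂)).image (fun q : ℕ × ℕ => (![i + q.1, j + q.2] : Site 2 L)),
          w (plaquetteHolonomy U p 0 1) ∂(Measure.pi fun _ : Edge 2 L => haarProbability G)) *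
      ∫ U, Φ₂ U *
        ∏ p ∈ (range R₀ ×ˢ range (c₁ + k + T₂)).image (fun q : ℕ × ℕ => (![i + q.1, j + q.2] : Site 2 L)),
          w (plaquetteHolonomy U p 0 1) ∂(Measure.pi fun _ : Edge 2 L => haarProbability G) := by
  have h := integral_mul_mul_prod_mul_integral_prod_eq_rows hw i j hk hfit hR
    (Complex.continuous_ofReal.comp hΦ₁) (Complex.continuous_ofReal.comp hΦ₂)
    (fun e U g he => by
      show ((Φ₁ (update U e g) : ℝ) : ℂ) = (Φ₁ U : ℂ)
      rw [hΦ₁e e U g he])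
    (fun e U g he => by
      show ((Φ₂ (update U e g) : ℝ) : ℂ) = (Φ₂ U : ℂ)
      rw [hΦ₂e e U g he])
  apply Complex.ofReal_injective
  rw [Complex.ofReal_mul, Complex.ofReal_mul, ← integral_complex_ofReal, ← integral_complex_ofReal,
    ← integral_complex_ofReal, ← integral_complex_ofReal]
  simp only [Complex.ofReal_mul, Complex.ofReal_prod]
  exact h

end Free

/-! ## §2. On the torus: the covariance of separated observables is exponentially small in the volume -/

section Torus

variable {N : ℕ} (ρ : G →* Matrix (Fin N) (Fin N) ℂ)

/-- **THE TORUS COVARIANCE OF TWO LOCAL OBSERVABLES A ROW APART IS EXPONENTIALLY SMALL IN THE VOLUME.**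
Theory-2's torus Wilson state `⟨·⟩_L = wilsonExpectation ρ β` on `(ℤ/L)²` (`L ≥ 2`), continuous `ρ` with
`|Re tr ρ| ≤ B`, EVERY real `β`; `Φ₁`, `Φ₂` real continuous with `|Φ₁| ≤ A₁`, `|Φ₂| ≤ A₂`, `Φ₁` seeing only the
links of the plaquettes of `Q₁ = R₀ × c₁` at `(i, j)` and `Φ₂` only those of `Q₂ = R₀ × T₂` at `(i, j + c₁ + k)`,
`0 < k`, `c₁ + k + T₂ + 1 ≤ L`, `R₀ + 1 ≤ L`.  Then, with `m = ∫ e^{−β(N − Re tr ρ)} dHaar`,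
`|⟨Φ₁Φ₂⟩_L − ⟨Φ₁⟩_L ⟨Φ₂⟩_L| ≤ 6 A₁ A₂ e^{2|β|(N+B)} (1 − e^{−|β|(N+B)}/m)^{L² − R₀(c₁+k+T₂) − 1}`. -/
theorem abs_wilsonExpectation_mul_sub_mul_le_of_row_gap (hρ : Continuous ρ) (β : ℝ) {B : ℝ}
    (hB : ∀ g : G, |(ρ g).trace.re| ≤ B) (hL : 2 ≤ L) (i j : ZMod L) {c₁ k T₂ R₀ : ℕ} (hk : 0 < k)
    (hfit : c₁ + k + T₂ + 1 ≤ L) (hR : R₀ + 1 ≤ L)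
    {Φ₁ Φ₂ : GaugeConfig 2 L G → ℝ} (hΦ₁ : Continuous Φ₁) (hΦ₂ : Continuous Φ₂)
    (hΦ₁e : ∀ (e : Edge 2 L) (U : GaugeConfig 2 L G) (g : G),
      (∀ p ∈ (range R₀ ×ˢ range c₁).image (fun q : ℕ × ℕ => (![i + q.1, j + q.2] : Site 2 L)),
        ((p, 0) : Edge 2 L) ≠ e ∧ ((Site.shift p 0, 1) : Edge 2 L) ≠ e ∧
          ((Site.shift p 1, 0) : Edge 2 L) ≠ e ∧ ((p, 1) : Edge 2 L) ≠ e) → Φ₁ (update U e g) = Φ₁ U)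
    (hΦ₂e : ∀ (e : Edge 2 L) (U : GaugeConfig 2 L G) (g : G),
      (∀ p ∈ (range R₀ ×ˢ range T₂).image (fun q : ℕ × ℕ => (![i + q.1, j + c₁ + k + q.2] : Site 2 L)),
        ((p, 0) : Edge 2 L) ≠ e ∧ ((Site.shift p 0, 1) : Edge 2 L) ≠ e ∧
          ((Site.shift p 1, 0) : Edge 2 L) ≠ e ∧ ((p, 1) : Edge 2 L) ≠ e) → Φ₂ (update U e g) = Φ₂ U)
    {A₁ A₂ : ℝ} (hA₁ : ∀ U, |Φ₁ U| ≤ A₁) (hA₂ : ∀ U, |Φ₂ U| ≤ A₂) :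
    |wilsonExpectation ρ β (fun U => Φ₁ U * Φ₂ U) - wilsonExpectation ρ β Φ₁ * wilsonExpectation ρ β Φ₂| ≤
      6 * A₁ * A₂ * Real.exp (2 * (|β| * (N + B))) *
        (1 - Real.exp (-(|β| * (N + B))) /
          ∫ g, Real.exp (-(β * ((N : ℝ) - (ρ g).trace.re))) ∂(haarProbability G)) ^
            (L ^ 2 - R₀ * (c₁ + k + T₂) - 1) := by
  set Reg := (range R₀ ×ˢ range (c₁ + k + T₂)).image (fun q : ℕ × ℕ => (![i + q.1, j + q.2] : Site 2 L))
    with hReg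
  set w : G → ℝ := fun g => Real.exp (-(β * ((N : ℝ) - (ρ g).trace.re))) with hw_def
  set π : Measure (GaugeConfig 2 L G) := Measure.pi fun _ : Edge 2 L => haarProbability G with hπ
  set X : ℝ := Real.exp (2 * (|β| * (N + B))) *
    (1 - Real.exp (-(|β| * (N + B))) / ∫ g, w g ∂(haarProbability G)) ^ (L ^ 2 - R₀ * (c₁ + k + T₂) - 1)
    with hX
  have hw : Continuous w := by
    have := Complex.continuous_re.comp hρ.matrix_trace
    simp only [hw_def]
    fun_prop
  have hA₁0 : 0 ≤ A₁ := (abs_nonneg _).trans (hA₁ 1)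
  have hA₂0 : 0 ≤ A₂ := (abs_nonneg _).trans (hA₂ 1)
  -- the sub-blocks lie in the block
  have hQ₁sub : ∀ p ∈ (range R₀ ×ˢ range c₁).image (fun q : ℕ × ℕ => (![i + q.1, j + q.2] : Site 2 L)),
      p ∈ Reg := by
    intro p hp
    obtain ⟨⟨a, b⟩, hq, rfl⟩ := Finset.mem_image.mp hp
    rw [Finset.mem_product, Finset.mem_range, Finset.mem_range] at hq
    exact Finset.mem_image.mpr ⟨(a, b), Finset.mem_product.mpr ⟨Finset.mem_range.mpr hq.1,
      Finset.mem_range.mpr (by omega)⟩, rfl⟩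
  have hQ₂sub : ∀ p ∈ (range R₀ ×ˢ range T₂).image
      (fun q : ℕ × ℕ => (![i + q.1, j + c₁ + k + q.2] : Site 2 L)), p ∈ Reg := by
    intro p hp
    obtain ⟨⟨a, b⟩, hq, rfl⟩ := Finset.mem_image.mp hp
    rw [Finset.mem_product, Finset.mem_range, Finset.mem_range] at hq
    refine Finset.mem_image.mpr ⟨(a, c₁ + k + b), Finset.mem_product.mpr ⟨Finset.mem_range.mpr hq.1,
      Finset.mem_range.mpr (by omega)⟩, ?_⟩
    show (![i + (a : ZMod L), j + ((c₁ + k + b : ℕ) : ZMod L)] : Site 2 L) = ![i + a, j + c₁ + k + b]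
    push_cast
    rw [add_assoc, add_assoc, add_assoc]
  -- localities relative to the block
  have hloc₁ : ∀ (e : Edge 2 L) (U : GaugeConfig 2 L G) (g : G),
      (∀ p ∈ Reg, ((p, 0) : Edge 2 L) ≠ e ∧ ((Site.shift p 0, 1) : Edge 2 L) ≠ e ∧
        ((Site.shift p 1, 0) : Edge 2 L) ≠ e ∧ ((p, 1) : Edge 2 L) ≠ e) → Φ₁ (update U e g) = Φ₁ U :=
    fun e U g he => hΦ₁e e U g fun p hp => he p (hQ₁sub p hp)
  have hloc₂ : ∀ (e : Edge 2 L) (U : GaugeConfig 2 L G) (g : G),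
      (∀ p ∈ Reg, ((p, 0) : Edge 2 L) ≠ e ∧ ((Site.shift p 0, 1) : Edge 2 L) ≠ e ∧
        ((Site.shift p 1, 0) : Edge 2 L) ≠ e ∧ ((p, 1) : Edge 2 L) ≠ e) → Φ₂ (update U e g) = Φ₂ U :=
    fun e U g he => hΦ₂e e U g fun p hp => he p (hQ₂sub p hp)
  have hloc₁₂ : ∀ (e : Edge 2 L) (U : GaugeConfig 2 L G) (g : G),
      (∀ p ∈ Reg, ((p, 0) : Edge 2 L) ≠ e ∧ ((Site.shift p 0, 1) : Edge 2 L) ≠ e ∧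
        ((Site.shift p 1, 0) : Edge 2 L) ≠ e ∧ ((p, 1) : Edge 2 L) ≠ e) →
      (fun U => Φ₁ U * Φ₂ U) (update U e g) = (fun U => Φ₁ U * Φ₂ U) U := by
    intro e U g he
    show Φ₁ (update U e g) * Φ₂ (update U e g) = Φ₁ U * Φ₂ U
    rw [hloc₁ e U g he, hloc₂ e U g he]
  have hA₁₂ : ∀ U, |(fun U => Φ₁ U * Φ₂ U) U| ≤ A₁ * A₂ := fun U => by
    show |Φ₁ U * Φ₂ U| ≤ A₁ * A₂
    rw [abs_mul]
    exact mul_le_mul (hA₁ U) (hA₂ U) (abs_nonneg _) hA₁0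
  -- part V-h: the three torus expectations against their free-boundary ratios
  set I₁₂ : ℝ := ∫ U, Φ₁ U * Φ₂ U * ∏ p ∈ Reg, w (plaquetteHolonomy U p 0 1) ∂π with hI₁₂
  set I₁ : ℝ := ∫ U, Φ₁ U * ∏ p ∈ Reg, w (plaquetteHolonomy U p 0 1) ∂π with hI₁
  set I₂ : ℝ := ∫ U, Φ₂ U * ∏ p ∈ Reg, w (plaquetteHolonomy U p 0 1) ∂π with hI₂
  set Z : ℝ := ∫ U, ∏ p ∈ Reg, w (plaquetteHolonomy U p 0 1) ∂π with hZ
  have hc12 : Continuous fun U => Φ₁ U * Φ₂ U := hΦ₁.mul hΦ₂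
  have h12 := abs_wilsonExpectation_local_sub_le ρ hρ β hB hL i j hR hfit hc12 hloc₁₂ hA₁₂
  have h1 := abs_wilsonExpectation_local_sub_le ρ hρ β hB hL i j hR hfit hΦ₁ hloc₁ hA₁
  have h2 := abs_wilsonExpectation_local_sub_le ρ hρ β hB hL i j hR hfit hΦ₂ hloc₂ hA₂
  have h12' : |wilsonExpectation ρ β (fun U => Φ₁ U * Φ₂ U) - I₁₂ / Z| ≤ 2 * (A₁ * A₂) * X := by
    refine h12.trans (le_of_eq ?_); simp only [hX]; ring
  have h1' : |wilsonExpectation ρ β Φ₁ - I₁ / Z| ≤ 2 * A₁ * X := by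
    refine h1.trans (le_of_eq ?_); simp only [hX]; ring
  have h2' : |wilsonExpectation ρ β Φ₂ - I₂ / Z| ≤ 2 * A₂ * X := by
    refine h2.trans (le_of_eq ?_); simp only [hX]; ring
  -- the free-boundary covariance vanishes (§1) and `Z > 0`
  have hZI : I₁₂ * Z = I₁ * I₂ :=
    integral_mul_mul_prod_mul_integral_prod_eq_rows_real hw i j hk hfit hR hΦ₁ hΦ₂ hΦ₁e hΦ₂e
  have hwpos : ∀ g, 0 < w g := fun g => Real.exp_pos _
  have hprodc : Continuous fun U : GaugeConfig 2 L G => ∏ p ∈ Reg, w (plaquetteHolonomy U p 0 1) :=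
    continuous_finsetProd _ fun p _ => hw.comp (continuous_config_plaquetteHolonomy p 0 1)
  have hZpos : 0 < Z := by
    have hc : ∃ c : ℝ, 0 < c ∧ ∀ g, c ≤ w g := by
      refine ⟨Real.exp (-(|β| * (N + B))), Real.exp_pos _, fun g => Real.exp_le_exp.mpr ?_⟩
      have h1 := hB g
      have h2 : |β * ((N : ℝ) - (ρ g).trace.re)| ≤ |β| * (N + B) := by
        rw [abs_mul]
        refine mul_le_mul_of_nonneg_left ?_ (abs_nonneg β)
        have h3 : |((N : ℝ) - (ρ g).trace.re)| ≤ |(N : ℝ)| + |(ρ g).trace.re| := abs_sub _ _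
        rw [Nat.abs_cast] at h3
        linarith
      linarith [(abs_le.mp h2).2]
    obtain ⟨c, hc0, hcw⟩ := hc
    haveI : IsProbabilityMeasure π := by rw [hπ]; infer_instance
    have hle : ∫ _U : GaugeConfig 2 L G, c ^ Reg.card ∂π ≤ Z :=
      integral_mono (integrable_const _) (integrable_gaugeConfig_of_continuous hprodc) fun U => by
        show c ^ Reg.card ≤ ∏ p ∈ Reg, w (plaquetteHolonomy U p 0 1)
        rw [← Finset.prod_const]
        exact Finset.prod_le_prod (fun p _ => hc0.le) fun p _ => hcw _
    have hconst : ∫ _U : GaugeConfig 2 L G, c ^ Reg.card ∂π = c ^ Reg.card := by simp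
    linarith [pow_pos hc0 Reg.card]
  have hr : I₁₂ / Z = I₁ / Z * (I₂ / Z) := by
    field_simp
    linear_combination hZI
  -- `|I₁ / Z| ≤ A₁` and `|⟨Φ₂⟩| ≤ A₂`
  have hnn : ∀ U : GaugeConfig 2 L G, 0 ≤ ∏ p ∈ Reg, w (plaquetteHolonomy U p 0 1) :=
    fun U => Finset.prod_nonneg fun p _ => (hwpos _).le
  have hI₁le : |I₁| ≤ A₁ * Z := by
    rw [hI₁, hZ, ← integral_const_mul]
    refine (abs_integral_le_integral_abs).trans (integral_mono_of_nonneg (ae_of_all _ fun U => abs_nonneg _)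
      ((integrable_gaugeConfig_of_continuous hprodc).const_mul _) (ae_of_all _ fun U => ?_))
    show |Φ₁ U * ∏ p ∈ Reg, w (plaquetteHolonomy U p 0 1)| ≤ A₁ * ∏ p ∈ Reg, w (plaquetteHolonomy U p 0 1)
    rw [abs_mul, abs_of_nonneg (hnn U)]
    exact mul_le_mul_of_nonneg_right (hA₁ U) (hnn U)
  have hr₁ : |I₁ / Z| ≤ A₁ := by
    rw [abs_div, abs_of_pos hZpos, div_le_iff₀ hZpos]
    exact hI₁le
  have hE₂ : |wilsonExpectation ρ β Φ₂| ≤ A₂ := by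
    haveI := isProbabilityMeasure_wilsonMeasure (d := 2) (L := L) ρ hρ β
    refine (abs_wilsonExpectation_le ρ β Φ₂).trans ?_
    calc wilsonExpectation ρ β (fun U => |Φ₂ U|) ≤ ∫ _U, A₂ ∂(wilsonMeasure ρ β) :=
          integral_mono_of_nonneg (Filter.Eventually.of_forall fun U => abs_nonneg _) (integrable_const A₂)
            (Filter.Eventually.of_forall hA₂)
      _ = A₂ := by simp
  -- assemble: `E₁₂ − E₁E₂ = (E₁₂ − r₁r₂) + r₁(r₂ − E₂) + E₂(r₁ − E₁)`
  have key : wilsonExpectation ρ β (fun U => Φ₁ U * Φ₂ U) - wilsonExpectation ρ β Φ₁ * wilsonExpectation ρ β Φ₂ =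
      (wilsonExpectation ρ β (fun U => Φ₁ U * Φ₂ U) - I₁₂ / Z) +
        I₁ / Z * (I₂ / Z - wilsonExpectation ρ β Φ₂) +
        wilsonExpectation ρ β Φ₂ * (I₁ / Z - wilsonExpectation ρ β Φ₁) := by
    rw [hr]; ring
  have hb : |I₁ / Z * (I₂ / Z - wilsonExpectation ρ β Φ₂)| ≤ A₁ * (2 * A₂ * X) := by
    rw [abs_mul]
    refine mul_le_mul hr₁ ?_ (abs_nonneg _) hA₁0
    rwa [abs_sub_comm]
  have hc : |wilsonExpectation ρ β Φ₂ * (I₁ / Z - wilsonExpectation ρ β Φ₁)| ≤ A₂ * (2 * A₁ * X) := by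
    rw [abs_mul]
    refine mul_le_mul hE₂ ?_ (abs_nonneg _) hA₂0
    rwa [abs_sub_comm]
  rw [key]
  calc |(wilsonExpectation ρ β (fun U => Φ₁ U * Φ₂ U) - I₁₂ / Z) +
          I₁ / Z * (I₂ / Z - wilsonExpectation ρ β Φ₂) +
          wilsonExpectation ρ β Φ₂ * (I₁ / Z - wilsonExpectation ρ β Φ₁)|
        ≤ |wilsonExpectation ρ β (fun U => Φ₁ U * Φ₂ U) - I₁₂ / Z| +
            |I₁ / Z * (I₂ / Z - wilsonExpectation ρ β Φ₂)| +
            |wilsonExpectation ρ β Φ₂ * (I₁ / Z - wilsonExpectation ρ β Φ₁)| := abs_add_three _ _ _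
    _ ≤ 2 * (A₁ * A₂) * X + A₁ * (2 * A₂ * X) + A₂ * (2 * A₁ * X) := add_le_add (add_le_add h12' hb) hc
    _ = 6 * A₁ * A₂ * Real.exp (2 * (|β| * (N + B))) *
        (1 - Real.exp (-(|β| * (N + B))) /
          ∫ g, Real.exp (-(β * ((N : ℝ) - (ρ g).trace.re))) ∂(haarProbability G)) ^
            (L ^ 2 - R₀ * (c₁ + k + T₂) - 1) := by
      simp only [hX]; ring

end Torus

end Summit.Ventures.LatticeQCDFlow.Scoring
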